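import Literature.AlgebraicGeometry.Shioda1982.ExceptionalQuadruples
import Literature.AlgebraicGeometry.HodgeTheory.FermatSurfaceHodgeCharacterStructure
import HarnessLib

/-!
# From "standard quadruple" (Meyer–Neutsch) to the letter of Aoki–Shioda's Theorem `(𝔅²ₘ)` (ii) — a generic bridge

Topic `Literature/AlgebraicGeometry/Shioda1982`. THEOREMS only (no definition, no named fact, no `sorry`).

The tree states the structure theorem of the Hodge characters of the Fermat surface in two vocabularies:
* multisets: `IsStandardQuadruple m s` (`ExceptionalQuadruples.lean`) — `s` is a unit multiple of Meyer–Neutsch's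
  `L₁ = (1, K, K+1, 2K−2)`, `L₂ = (1, K+1, K+2, 2K−4)` (`N = 2K`) or `L₃ = (1, K+1, 2K+1, 3K−3)` (`N = 3K`)
  [MeyerNeutsch1981Fermatquadrupel, (13)–(15) p. 53], and `IsExceptionalQuadruple m s` (four entries, Hodge, no pair, primitive, not standard);
* tuples: the LETTER of the named fact `HodgeTheory.AokiShioda1983_thmB2m_standard` (`FermatSurfaceHodgeCharacterStructure.lean`):
  an indecomposable Hodge character `α : Fin 4 → ℤ/m` with `GCD = 1` is, after a permutation `σ` of its coordinates, one of
  `αᵢ = (i, d+i, m−2i, d)`, `βᵢ = (i, d+i, d+2i, m−4i)` (`m = 2d`, `1 ≤ i < d`, `(i,d) = 1`, `i ≠ m/4` resp. `i ≠ m/3, m/4, m/6`) or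
  `γⱼ = (j, d+j, 2d+j, m−3j)` (`m = 3d`, `1 ≤ j < d`, `(j,d) = 1`, `j ≠ m/6`) [AokiShioda1983, §2 Thm (𝔅²ₘ) (ii) a)–c)].
Every level family of the series `PicardNumber*.lean` re-derives the passage between the two in ≈ 120 private lines. This file proves it ONCE:

* `letter_of_isStandardQuadruple` — if the multiset of values of `α` (all `αᵢ ≠ 0`, `αᵢ + αⱼ ≠ 0` for `i ≠ j`) is a standard quadruple,
  then `α` satisfies the letter of `(𝔅²ₘ)` (ii): `t·L₁ = α_t` etc. (`t·K = K` for the odd unit `t`, `t·K₃ ∈ {K₃, 2K₃}`), with `i = ⟨t⟩ mod d`;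
  the printed side conditions `i ≠ m/4`, … are exactly the indecomposability / non-vanishing of the entries.
* `letter_of_forall_not_isExceptionalQuadruple` — at a level `m` WITHOUT exceptional quadruples, every indecomposable Hodge character of
  length `4` with `GCD = 1` satisfies the letter (the shape in which kernel sweeps `not_isExceptionalQuadruple_N` and classifications
  `isStandardQuadruple_of_…` feed the named fact).
* the two hypothesis conversions every classification needs: `pairfree_of_indecomposable` / `not_hasPair_of_indecomposable`
  (indecomposable ⇒ no pair among the values) and `isPrimitive_of_forall_dvd` (`GCD(aᵢ) = 1` ⇒ Meyer–Neutsch primitivity); the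
  permutation / `gcd` / `t·K = K` plumbing is private (uncited helper statements stay out of the Literature name space).

HONEST FRAMING (cell `pub-hfermat`): explicit algebraic cycles for specific Hodge classes on Fermat/Delsarte varieties; residual open
instances listed; no claim on general Hodge. (Surface classes are algebraic by Lefschetz (1,1); this file is bookkeeping between two
printed formulations of one structure theorem and proves no case of it.)

## References
* [MeyerNeutsch1981Fermatquadrupel] W. Meyer, W. Neutsch, *Fermatquadrupel*, Math. Ann. 256 (1981) 51–62, (13)–(15) p. 53 (Standardquadrupel).
* [AokiShioda1983] N. Aoki, T. Shioda, *Generators of the Néron–Severi group of a Fermat surface*, Progr. Math. 35 (1983) 1–12, §2 Thm (𝔅²ₘ) (ii).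
* [Shioda1982PicardFermat] T. Shioda, J. Fac. Sci. Univ. Tokyo IA 28 (1982) 725–734, Lemma 1 p. 728 (`αᵢ, βᵢ, γⱼ`), Prop. 4 (Q′) p. 729.
-/

namespace Literature.AlgebraicGeometry.Shioda1982

open Finset Multiset Literature.AlgebraicGeometry.HodgeTheory Literature.AlgebraicGeometry.HodgeTheory.FermatCharacter

variable {m : ℕ}

/-! ### Tuples versus multisets of values -/

/-- Tuples with the same multiset of values differ by a permutation of the indices. [folklore] -/
private theorem exists_perm_of_univ_val_map_eq {K : ℕ} {X : Type*} [DecidableEq X] {x y : Fin K → X}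
    (h : univ.val.map x = univ.val.map y) : ∃ σ : Equiv.Perm (Fin K), y = x ∘ σ := by
  have hc : ∀ a : X, Fintype.card {i // y i = a} = Fintype.card {i // x i = a} := by
    intro a
    rw [Fintype.card_subtype, Fintype.card_subtype]
    have h1 : ∀ (z : Fin K → X), (univ.filter fun i ↦ z i = a).card = Multiset.count a (univ.val.map z) := by
      intro z
      rw [Multiset.count_map, ← Finset.filter_val, Finset.card_val]
      congr 1
      exact Finset.filter_congr fun i _ ↦ eq_comm
    rw [h1, h1, h]
  have e : ∀ a : X, {i // y i = a} ≃ {i // x i = a} := fun a ↦ Fintype.equivOfCardEq (hc a)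
  exact ⟨Equiv.ofFiberEquiv e, funext fun i ↦ (Equiv.ofFiberEquiv_map e i).symm⟩

/-- The multiset of values of an explicit `4`-tuple. [folklore] -/
private theorem univ_val_map_vecFour {X : Type*} (a b c d : X) :
    (univ : Finset (Fin 4)).val.map ![a, b, c, d] = {a, b, c, d} := by
  simp
  rfl

/-- From a multiset identity `values(α) = {a, b, c, d}` to a permutation `σ` with `α ∘ σ = (a, b, c, d)`. [folklore] -/
private theorem exists_perm_of_univ_val_map_eq_quad {X : Type*} [DecidableEq X] {α : Fin 4 → X} {a b c d : X}
    (h : univ.val.map α = {a, b, c, d}) : ∃ σ : Equiv.Perm (Fin 4), ∀ k, α (σ k) = ![a, b, c, d] k := by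
  rw [← univ_val_map_vecFour] at h
  obtain ⟨σ, hσ⟩ := exists_perm_of_univ_val_map_eq h
  exact ⟨σ, fun k ↦ (congrFun hσ k).symm⟩

/-! ### Indecomposable tuples have pair-free multisets of values -/

/-- Indecomposability (`αᵢ + αⱼ ≠ 0` for `i ≠ j`) in terms of the multiset of values (the hypothesis shape of the classification
files `classify_hodgeMultiset_*`). [cite: Shioda1982PicardFermat, §2 p. 726 (decomposable elements)] -/
theorem pairfree_of_indecomposable {α : Fin 4 → ZMod m} (hind : ∀ i j : Fin 4, i ≠ j → α i + α j ≠ 0) :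
    ∀ a ∈ univ.val.map α, ∀ b ∈ (univ.val.map α).erase a, a + b ≠ 0 := by
  classical
  intro a ha b hb hab
  obtain ⟨i, -, rfl⟩ := Multiset.mem_map.mp ha
  by_cases hba : b = α i
  · have h2 : 2 ≤ count (α i) (univ.val.map α) := by
      have := Multiset.count_pos.mpr (hba ▸ hb)
      rw [Multiset.count_erase_self] at this
      omega
    rw [count_univ_val_map] at h2
    obtain ⟨j, hj, k, hk, hjk⟩ := Finset.one_lt_card.mp h2
    simp only [Finset.mem_filter, Finset.mem_univ, true_and] at hj hk
    exact hind j k hjk (by rw [hj, hk, ← hba]; nth_rw 1 [hba]; exact hab)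
  · have hb' : b ∈ univ.val.map α := Multiset.mem_of_mem_erase hb
    obtain ⟨j, -, rfl⟩ := Multiset.mem_map.mp hb'
    exact hind i j (fun e ↦ hba (by rw [e])) hab

/-- An indecomposable tuple has no pair `(x, −x)` among its values. [cite: Shioda1982PicardFermat, §2 p. 726] -/
theorem not_hasPair_of_indecomposable {α : Fin 4 → ZMod m} (hind : ∀ i j : Fin 4, i ≠ j → α i + α j ≠ 0) :
    ¬ HasPair (univ.val.map α) := by
  rintro ⟨a, ha, hna⟩
  exact pairfree_of_indecomposable hind a ha (-a) hna (add_neg_cancel a)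

/-! ### Primitivity -/

/-- The iterated `gcd` of a multiset of naturals (with initial value `b`) divides every member. [folklore] -/
private theorem foldr_gcd_dvd_of_mem (L : Multiset ℕ) (b : ℕ) {v : ℕ} (hv : v ∈ L) : L.foldr Nat.gcd b ∣ v := by
  induction L using Multiset.induction_on with
  | empty => exact absurd hv (Multiset.notMem_zero v)
  | cons a s ih =>
    rw [Multiset.foldr_cons]
    rcases Multiset.mem_cons.mp hv with rfl | hv'
    · exact Nat.gcd_dvd_left _ _
    · exact dvd_trans (Nat.gcd_dvd_right _ _) (ih hv')

/-- `GCD(aᵢ) = 1` in the letter of the named fact (no `g > 1` divides all representatives) implies Meyer–Neutsch primitivity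
`gcd(a₁, …, a₄, m) = 1` of the multiset of values. [cite: MeyerNeutsch1981Fermatquadrupel, (9)–(10) p. 52] -/
theorem isPrimitive_of_forall_dvd {r : ℕ} {α : Fin r → ZMod m} (hprim : ∀ g : ℕ, (∀ i, g ∣ (α i).val) → g = 1) :
    IsPrimitive m (univ.val.map α) := by
  unfold IsPrimitive
  refine hprim _ fun i ↦ foldr_gcd_dvd_of_mem _ _ ?_
  exact Multiset.mem_map.mpr ⟨α i, Multiset.mem_map.mpr ⟨i, Finset.mem_univ_val i, rfl⟩, rfl⟩

/-! ### The bridge -/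

section Bridge

variable [NeZero m]

/-- A unit of `ℤ/m`, `2 ∣ m`, fixes `K = m/2`: `t·K = K` (`⟨t⟩` is odd). [folklore] -/
private theorem unit_mul_half (h2 : 2 ∣ m) (t : (ZMod m)ˣ) :
    (t : ZMod m) * ((m / 2 : ℕ) : ZMod m) = ((m / 2 : ℕ) : ZMod m) := by
  have hcop : Nat.Coprime (t : ZMod m).val m := ZMod.val_coe_unit_coprime t
  have hodd : (t : ZMod m).val % 2 = 1 := by
    by_contra h
    have h0 : 2 ∣ (t : ZMod m).val := Nat.dvd_of_mod_eq_zero (by omega)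
    have h21 : 2 ∣ Nat.gcd (t : ZMod m).val m := Nat.dvd_gcd h0 h2
    rw [Nat.Coprime.gcd_eq_one hcop] at h21
    exact absurd (Nat.le_of_dvd one_pos h21) (by norm_num)
  have hK2 : (2 : ZMod m) * ((m / 2 : ℕ) : ZMod m) = 0 := by
    have : ((2 * (m / 2) : ℕ) : ZMod m) = 0 := by rw [Nat.mul_div_cancel' h2, ZMod.natCast_self]
    exact_mod_cast this
  conv_lhs => rw [← ZMod.natCast_zmod_val (t : ZMod m), ← Nat.div_add_mod (t : ZMod m).val 2, hodd]
  push_cast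
  linear_combination (((t : ZMod m).val / 2 : ℕ) : ZMod m) * hK2

/-- A unit of `ℤ/m`, `3 ∣ m`, maps `K₃ = m/3` to `K₃` or `2K₃`. [folklore] -/
private theorem unit_mul_third (h3 : 3 ∣ m) (t : (ZMod m)ˣ) :
    (t : ZMod m) * ((m / 3 : ℕ) : ZMod m) = ((m / 3 : ℕ) : ZMod m) ∨
      (t : ZMod m) * ((m / 3 : ℕ) : ZMod m) = 2 * ((m / 3 : ℕ) : ZMod m) := by
  have hcop : Nat.Coprime (t : ZMod m).val m := ZMod.val_coe_unit_coprime t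
  have hK3 : (3 : ZMod m) * ((m / 3 : ℕ) : ZMod m) = 0 := by
    have : ((3 * (m / 3) : ℕ) : ZMod m) = 0 := by rw [Nat.mul_div_cancel' h3, ZMod.natCast_self]
    exact_mod_cast this
  have hr : (t : ZMod m).val % 3 = 1 ∨ (t : ZMod m).val % 3 = 2 := by
    have hne : (t : ZMod m).val % 3 ≠ 0 := fun h ↦ by
      have h0 : 3 ∣ (t : ZMod m).val := Nat.dvd_of_mod_eq_zero h
      have h31 : 3 ∣ Nat.gcd (t : ZMod m).val m := Nat.dvd_gcd h0 h3
      rw [Nat.Coprime.gcd_eq_one hcop] at h31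
      exact absurd (Nat.le_of_dvd one_pos h31) (by norm_num)
    omega
  have key : (t : ZMod m) * ((m / 3 : ℕ) : ZMod m) = (((t : ZMod m).val % 3 : ℕ) : ZMod m) * ((m / 3 : ℕ) : ZMod m) := by
    conv_lhs => rw [← ZMod.natCast_zmod_val (t : ZMod m), ← Nat.div_add_mod (t : ZMod m).val 3]
    push_cast
    linear_combination (((t : ZMod m).val / 3 : ℕ) : ZMod m) * hK3
  rcases hr with hr | hr
  · left; rw [key, hr]; push_cast; ring
  · right; rw [key, hr]; push_cast; ring

/-- **Standard quadruple ⇒ the letter of `(𝔅²ₘ)` (ii).** Let `α : Fin 4 → ℤ/m` have non-zero, pairwise non-opposite entries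
(`αᵢ ≠ 0`, `αᵢ + αⱼ ≠ 0` for `i ≠ j`) and let its multiset of values be a standard quadruple (a unit multiple `t·L₁`, `t·L₂` or `t·L₃`).
Then `α` is, up to a permutation of the coordinates, `αᵢ = (i, d+i, −2i, d)` or `βᵢ = (i, d+i, d+2i, −4i)` (`m = 2d`) or
`γⱼ = (j, d+j, 2d+j, −3j)` (`m = 3d`) with the printed side conditions, where `i` resp. `j` is `⟨t⟩ mod d`.
[cite: MeyerNeutsch1981Fermatquadrupel, (13)–(15) p. 53] [cite: AokiShioda1983, §2 Thm (𝔅²ₘ) (ii) a)–c)] [cite: Shioda1982PicardFermat, Lemma 1 p. 728] -/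
theorem letter_of_isStandardQuadruple {α : Fin 4 → ZMod m} (h0 : ∀ i, α i ≠ 0)
    (hind : ∀ i j : Fin 4, i ≠ j → α i + α j ≠ 0) (hstd : IsStandardQuadruple m (univ.val.map α)) :
    ∃ σ : Equiv.Perm (Fin 4),
      (∃ d i : ℕ, m = 2 * d ∧ 1 ≤ i ∧ i < d ∧ Nat.Coprime i d ∧ 4 * i ≠ m ∧
          ∀ k, α (σ k) = ![(i : ZMod m), (d : ZMod m) + i, -(2 * (i : ZMod m)), (d : ZMod m)] k) ∨
      (∃ d i : ℕ, m = 2 * d ∧ 1 ≤ i ∧ i < d ∧ Nat.Coprime i d ∧ 3 * i ≠ m ∧ 4 * i ≠ m ∧ 6 * i ≠ m ∧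
          ∀ k, α (σ k) = ![(i : ZMod m), (d : ZMod m) + i, (d : ZMod m) + 2 * i, -(4 * (i : ZMod m))] k) ∨
      (∃ d j : ℕ, m = 3 * d ∧ 1 ≤ j ∧ j < d ∧ Nat.Coprime j d ∧ 6 * j ≠ m ∧
          ∀ k, α (σ k) = ![(j : ZMod m), (d : ZMod m) + j, 2 * (d : ZMod m) + j, -(3 * (j : ZMod m))] k) := by
  classical
  have hm0 : 0 < m := Nat.pos_of_ne_zero (NeZero.ne m)
  -- the value multiset has no `0` and no opposite pair at distinct positions
  have val_ne : ∀ {v : Fin 4 → ZMod m} (σ : Equiv.Perm (Fin 4)), (∀ k, α (σ k) = v k) → ∀ k, v k ≠ 0 :=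
    fun σ hσ k hk ↦ h0 (σ k) ((hσ k).trans hk)
  have val_add_ne : ∀ {v : Fin 4 → ZMod m} (σ : Equiv.Perm (Fin 4)), (∀ k, α (σ k) = v k) →
      ∀ k l, k ≠ l → v k + v l ≠ 0 :=
    fun σ hσ k l hkl h ↦ hind (σ k) (σ l) (fun e ↦ hkl (σ.injective e)) (by rw [hσ k, hσ l]; exact h)
  obtain ⟨t, ⟨h2, hL | hL⟩ | ⟨h3, hL⟩⟩ := hstd
  · -- `t · L₁`
    obtain ⟨d, hmd⟩ := h2
    have hd2 : m / 2 = d := by omega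
    have hd0 : 0 < d := by omega
    have hK2 : (2 : ZMod m) * (d : ZMod m) = 0 := by
      have : ((2 * d : ℕ) : ZMod m) = 0 := by rw [← hmd, ZMod.natCast_self]
      exact_mod_cast this
    have htK : (t : ZMod m) * (d : ZMod m) = (d : ZMod m) := by
      have := unit_mul_half ⟨d, hmd⟩ t
      rwa [hd2] at this
    -- `i = ⟨t⟩ mod d`, `t = i + q d`, `q ∈ {0, 1}`
    obtain ⟨i, hi⟩ : ∃ i : ℕ, (t : ZMod m).val % d = i := ⟨_, rfl⟩
    have hid : i < d := hi ▸ Nat.mod_lt _ hd0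
    have htlt : (t : ZMod m).val < 2 * d := hmd ▸ ZMod.val_lt _
    have hq : (t : ZMod m).val / d = 0 ∨ (t : ZMod m).val / d = 1 := by
      have h : (t : ZMod m).val / d < 2 := Nat.div_lt_of_lt_mul (by linarith)
      generalize (t : ZMod m).val / d = q at h ⊢
      omega
    have hdiv := Nat.mod_add_div (t : ZMod m).val d
    rw [hi] at hdiv
    have htv : (t : ZMod m) = (i : ZMod m) + (((t : ZMod m).val / d : ℕ) : ZMod m) * (d : ZMod m) := by
      conv_lhs => rw [← ZMod.natCast_zmod_val (t : ZMod m), ← hdiv]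
      push_cast
      ring
    have hcop : Nat.Coprime i d := by
      have h1 : Nat.Coprime (t : ZMod m).val m := ZMod.val_coe_unit_coprime t
      have h2' : Nat.Coprime (t : ZMod m).val d := Nat.Coprime.coprime_dvd_right (Dvd.intro_left 2 hmd.symm) h1
      rw [← hi, Nat.Coprime, ← Nat.gcd_rec, Nat.gcd_comm]
      exact h2'
    -- the multiset of values is `{i, d + i, -2i, d}`
    have hvals : univ.val.map α = {(i : ZMod m), (d : ZMod m) + i, -(2 * (i : ZMod m)), (d : ZMod m)} := by
      rw [hL, stdOne, hd2]
      simp only [Multiset.insert_eq_cons, Multiset.map_cons, Multiset.map_singleton, mul_one, mul_add, mul_sub, htK]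
      simp only [← Multiset.singleton_add]
      rcases hq with hq | hq
      · rw [hq] at htv
        simp only [Nat.cast_zero, zero_mul, add_zero] at htv
        rw [show (t : ZMod m) * (2 * (d : ZMod m)) - (t : ZMod m) * 2 = -(2 * (i : ZMod m)) by
          rw [htv]; linear_combination (i : ZMod m) * hK2, htv]
        abel
      · rw [hq] at htv
        simp only [Nat.cast_one, one_mul] at htv
        rw [show (t : ZMod m) * (2 * (d : ZMod m)) - (t : ZMod m) * 2 = -(2 * (i : ZMod m)) by
          rw [htv]; linear_combination ((i : ZMod m) + (d : ZMod m) - 1) * hK2, htv,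
          show (d : ZMod m) + ((i : ZMod m) + (d : ZMod m)) = (i : ZMod m) by linear_combination hK2,
          add_comm (i : ZMod m) (d : ZMod m)]
        abel
    obtain ⟨σ, hσ⟩ := exists_perm_of_univ_val_map_eq_quad hvals
    refine ⟨σ, Or.inl ⟨d, i, hmd, ?_, hid, hcop, ?_, hσ⟩⟩
    · by_contra hi0
      exact val_ne σ hσ 0 (show ((i : ℕ) : ZMod m) = 0 by rw [show i = 0 by omega, Nat.cast_zero])
    · intro h4
      -- `m = 4i`: then `d = 2i` and `-2i + d = 0`, a pair at the positions `2, 3`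
      have hdi : d = 2 * i := by omega
      exact val_add_ne σ hσ 2 3 (by decide) (show -(2 * (i : ZMod m)) + (d : ZMod m) = 0 by
        rw [hdi]; push_cast; ring)
  · -- `t · L₂`
    obtain ⟨d, hmd⟩ := h2
    have hd2 : m / 2 = d := by omega
    have hd0 : 0 < d := by omega
    have hK2 : (2 : ZMod m) * (d : ZMod m) = 0 := by
      have : ((2 * d : ℕ) : ZMod m) = 0 := by rw [← hmd, ZMod.natCast_self]
      exact_mod_cast this
    have htK : (t : ZMod m) * (d : ZMod m) = (d : ZMod m) := by
      have := unit_mul_half ⟨d, hmd⟩ t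
      rwa [hd2] at this
    obtain ⟨i, hi⟩ : ∃ i : ℕ, (t : ZMod m).val % d = i := ⟨_, rfl⟩
    have hid : i < d := hi ▸ Nat.mod_lt _ hd0
    have htlt : (t : ZMod m).val < 2 * d := hmd ▸ ZMod.val_lt _
    have hq : (t : ZMod m).val / d = 0 ∨ (t : ZMod m).val / d = 1 := by
      have h : (t : ZMod m).val / d < 2 := Nat.div_lt_of_lt_mul (by linarith)
      generalize (t : ZMod m).val / d = q at h ⊢
      omega
    have hdiv := Nat.mod_add_div (t : ZMod m).val d
    rw [hi] at hdiv
    have htv : (t : ZMod m) = (i : ZMod m) + (((t : ZMod m).val / d : ℕ) : ZMod m) * (d : ZMod m) := by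
      conv_lhs => rw [← ZMod.natCast_zmod_val (t : ZMod m), ← hdiv]
      push_cast
      ring
    have hcop : Nat.Coprime i d := by
      have h1 : Nat.Coprime (t : ZMod m).val m := ZMod.val_coe_unit_coprime t
      have h2' : Nat.Coprime (t : ZMod m).val d := Nat.Coprime.coprime_dvd_right (Dvd.intro_left 2 hmd.symm) h1
      rw [← hi, Nat.Coprime, ← Nat.gcd_rec, Nat.gcd_comm]
      exact h2'
    have hvals : univ.val.map α =
        {(i : ZMod m), (d : ZMod m) + i, (d : ZMod m) + 2 * i, -(4 * (i : ZMod m))} := by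
      rw [hL, stdTwo, hd2]
      simp only [Multiset.insert_eq_cons, Multiset.map_cons, Multiset.map_singleton, mul_one, mul_add, mul_sub, htK]
      simp only [← Multiset.singleton_add]
      rcases hq with hq | hq
      · rw [hq] at htv
        simp only [Nat.cast_zero, zero_mul, add_zero] at htv
        rw [show (t : ZMod m) * (2 * (d : ZMod m)) - (t : ZMod m) * 4 = -(4 * (i : ZMod m)) by
          rw [htv]; linear_combination (i : ZMod m) * hK2,
          show (t : ZMod m) * 2 = 2 * (i : ZMod m) by rw [htv]; ring, htv]
      · rw [hq] at htv
        simp only [Nat.cast_one, one_mul] at htv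
        rw [show (t : ZMod m) * (2 * (d : ZMod m)) - (t : ZMod m) * 4 = -(4 * (i : ZMod m)) by
          rw [htv]; linear_combination ((i : ZMod m) + (d : ZMod m) - 2) * hK2,
          show (t : ZMod m) * 2 = 2 * (i : ZMod m) by rw [htv]; linear_combination hK2, htv,
          show (d : ZMod m) + ((i : ZMod m) + (d : ZMod m)) = (i : ZMod m) by linear_combination hK2,
          add_comm (i : ZMod m) (d : ZMod m)]
        abel
    obtain ⟨σ, hσ⟩ := exists_perm_of_univ_val_map_eq_quad hvals
    refine ⟨σ, Or.inr (Or.inl ⟨d, i, hmd, ?_, hid, hcop, ?_, ?_, ?_, hσ⟩)⟩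
    · by_contra hi0
      exact val_ne σ hσ 0 (show ((i : ℕ) : ZMod m) = 0 by rw [show i = 0 by omega, Nat.cast_zero])
    · intro h3i
      -- `m = 3i`: `i + (-4i) = -3i = -m = 0`, a pair at the positions `0, 3`
      have e : (3 : ZMod m) * (i : ZMod m) = 0 := by
        have : ((3 * i : ℕ) : ZMod m) = 0 := by rw [h3i, ZMod.natCast_self]
        push_cast at this
        exact this
      exact val_add_ne σ hσ 0 3 (by decide) (show (i : ZMod m) + -(4 * (i : ZMod m)) = 0 by
        linear_combination -e)
    · intro h4i
      -- `m = 4i`: the entry `-4i` vanishes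
      have e : (4 : ZMod m) * (i : ZMod m) = 0 := by
        have : ((4 * i : ℕ) : ZMod m) = 0 := by rw [h4i, ZMod.natCast_self]
        push_cast at this
        exact this
      exact val_ne σ hσ 3 (show -(4 * (i : ZMod m)) = 0 by rw [e, neg_zero])
    · intro h6i
      -- `m = 6i`: `d = 3i` and `(d + i) + (-4i) = d - 3i = 0`, a pair at the positions `1, 3`
      have hdi : d = 3 * i := by omega
      exact val_add_ne σ hσ 1 3 (by decide) (show ((d : ZMod m) + i) + -(4 * (i : ZMod m)) = 0 by
        rw [hdi]; push_cast; ring)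
  · -- `t · L₃`
    obtain ⟨d, hmd⟩ := h3
    have hd3 : m / 3 = d := by omega
    have hd0 : 0 < d := by omega
    have hK3 : (3 : ZMod m) * (d : ZMod m) = 0 := by
      have : ((3 * d : ℕ) : ZMod m) = 0 := by rw [← hmd, ZMod.natCast_self]
      exact_mod_cast this
    obtain ⟨i, hi⟩ : ∃ i : ℕ, (t : ZMod m).val % d = i := ⟨_, rfl⟩
    have hid : i < d := hi ▸ Nat.mod_lt _ hd0
    have htlt : (t : ZMod m).val < 3 * d := hmd ▸ ZMod.val_lt _
    have hq : (t : ZMod m).val / d = 0 ∨ (t : ZMod m).val / d = 1 ∨ (t : ZMod m).val / d = 2 := by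
      have h : (t : ZMod m).val / d < 3 := Nat.div_lt_of_lt_mul (by linarith)
      generalize (t : ZMod m).val / d = q at h ⊢
      omega
    have hdiv := Nat.mod_add_div (t : ZMod m).val d
    rw [hi] at hdiv
    have htv : (t : ZMod m) = (i : ZMod m) + (((t : ZMod m).val / d : ℕ) : ZMod m) * (d : ZMod m) := by
      conv_lhs => rw [← ZMod.natCast_zmod_val (t : ZMod m), ← hdiv]
      push_cast
      ring
    have hcop : Nat.Coprime i d := by
      have h1 : Nat.Coprime (t : ZMod m).val m := ZMod.val_coe_unit_coprime t
      have h2' : Nat.Coprime (t : ZMod m).val d := Nat.Coprime.coprime_dvd_right (Dvd.intro_left 3 hmd.symm) h1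
      rw [← hi, Nat.Coprime, ← Nat.gcd_rec, Nat.gcd_comm]
      exact h2'
    -- the value multiset is `{t, t + d, t + 2d, -3t}` whichever of `t·K₃ ∈ {K₃, 2K₃}` holds
    have hvals0 : univ.val.map α =
        {(t : ZMod m), (t : ZMod m) + (d : ZMod m), (t : ZMod m) + 2 * (d : ZMod m), -(3 * (t : ZMod m))} := by
      rw [hL, stdThree, hd3]
      simp only [Multiset.insert_eq_cons, Multiset.map_cons, Multiset.map_singleton, mul_one, mul_add, mul_sub]
      simp only [← Multiset.singleton_add]
      rw [show (t : ZMod m) * (3 * (d : ZMod m)) - (t : ZMod m) * 3 = -(3 * (t : ZMod m)) by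
        linear_combination (t : ZMod m) * hK3]
      have ht3 := unit_mul_third ⟨d, hmd⟩ t
      rw [hd3] at ht3
      rcases ht3 with htK | htK
      · rw [show (t : ZMod m) * (2 * (d : ZMod m)) = 2 * (d : ZMod m) by
            rw [← mul_assoc, mul_comm _ (2 : ZMod m), mul_assoc, htK],
          htK, add_comm (d : ZMod m) (t : ZMod m), add_comm (2 * (d : ZMod m)) (t : ZMod m)]
      · rw [show (t : ZMod m) * (2 * (d : ZMod m)) = (d : ZMod m) by
            rw [← mul_assoc, mul_comm _ (2 : ZMod m), mul_assoc, htK]; linear_combination hK3,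
          htK, add_comm (2 * (d : ZMod m)) (t : ZMod m), add_comm (d : ZMod m) (t : ZMod m)]
        abel
    have hvals : univ.val.map α =
        {(i : ZMod m), (d : ZMod m) + i, 2 * (d : ZMod m) + i, -(3 * (i : ZMod m))} := by
      rw [hvals0]
      simp only [Multiset.insert_eq_cons, ← Multiset.singleton_add]
      rcases hq with hq | hq | hq
      · rw [hq] at htv
        simp only [Nat.cast_zero, zero_mul, add_zero] at htv
        rw [htv, add_comm (i : ZMod m) (d : ZMod m), add_comm (i : ZMod m) (2 * (d : ZMod m))]
      · rw [hq] at htv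
        simp only [Nat.cast_one, one_mul] at htv
        rw [show -(3 * (t : ZMod m)) = -(3 * (i : ZMod m)) by rw [htv]; linear_combination -hK3,
          show (t : ZMod m) + 2 * (d : ZMod m) = (i : ZMod m) by rw [htv]; linear_combination hK3,
          show (t : ZMod m) + (d : ZMod m) = 2 * (d : ZMod m) + i by rw [htv]; ring, htv,
          add_comm (i : ZMod m) (d : ZMod m)]
        abel
      · rw [hq] at htv
        rw [show -(3 * (t : ZMod m)) = -(3 * (i : ZMod m)) by rw [htv]; push_cast; linear_combination (-2 : ZMod m) * hK3,
          show (t : ZMod m) + 2 * (d : ZMod m) = (d : ZMod m) + i by rw [htv]; push_cast; linear_combination hK3,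
          show (t : ZMod m) + (d : ZMod m) = (i : ZMod m) by rw [htv]; push_cast; linear_combination hK3,
          show (t : ZMod m) = 2 * (d : ZMod m) + i by rw [htv]; push_cast; ring]
        abel
    obtain ⟨σ, hσ⟩ := exists_perm_of_univ_val_map_eq_quad hvals
    refine ⟨σ, Or.inr (Or.inr ⟨d, i, hmd, ?_, hid, hcop, ?_, hσ⟩)⟩
    · by_contra hi0
      exact val_ne σ hσ 0 (show ((i : ℕ) : ZMod m) = 0 by rw [show i = 0 by omega, Nat.cast_zero])
    · intro h6i
      -- `m = 6i`: `d = 2i` and `(d + i) + (-3i) = d - 2i = 0`, a pair at the positions `1, 3`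
      have hdi : d = 2 * i := by omega
      exact val_add_ne σ hσ 1 3 (by decide) (show ((d : ZMod m) + i) + -(3 * (i : ZMod m)) = 0 by
        rw [hdi]; push_cast; ring)

/-- **A level without exceptional quadruples satisfies the letter of `(𝔅²ₘ)` (ii).** If no multiset over `ℤ/m` is an exceptional
quadruple (e.g. by a kernel sweep `not_isExceptionalQuadruple_N`, or by a classification `isStandardQuadruple_of_…`), then every
indecomposable Hodge character `α : Fin 4 → ℤ/m` whose representatives have no common divisor `> 1` is, up to a permutation of its
coordinates, one of Aoki–Shioda's standard elements `αᵢ, βᵢ, γⱼ` with the printed side conditions — the body of the named fact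
`HodgeTheory.AokiShioda1983_thmB2m_standard` at the level `m`.
[cite: AokiShioda1983, §2 Thm (𝔅²ₘ) (ii) a)–c)] [cite: MeyerNeutsch1981Fermatquadrupel, p. 53 (Standard- und Ausnahmequadrupel)] -/
theorem letter_of_forall_not_isExceptionalQuadruple (hno : ∀ s : Multiset (ZMod m), ¬ IsExceptionalQuadruple m s)
    (α : Fin 4 → ZMod m) (hα : IsHodge α) (hind : ∀ i j : Fin 4, i ≠ j → α i + α j ≠ 0)
    (hprim : ∀ g : ℕ, (∀ i, g ∣ (α i).val) → g = 1) :
    ∃ σ : Equiv.Perm (Fin 4),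
      (∃ d i : ℕ, m = 2 * d ∧ 1 ≤ i ∧ i < d ∧ Nat.Coprime i d ∧ 4 * i ≠ m ∧
          ∀ k, α (σ k) = ![(i : ZMod m), (d : ZMod m) + i, -(2 * (i : ZMod m)), (d : ZMod m)] k) ∨
      (∃ d i : ℕ, m = 2 * d ∧ 1 ≤ i ∧ i < d ∧ Nat.Coprime i d ∧ 3 * i ≠ m ∧ 4 * i ≠ m ∧ 6 * i ≠ m ∧
          ∀ k, α (σ k) = ![(i : ZMod m), (d : ZMod m) + i, (d : ZMod m) + 2 * i, -(4 * (i : ZMod m))] k) ∨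
      (∃ d j : ℕ, m = 3 * d ∧ 1 ≤ j ∧ j < d ∧ Nat.Coprime j d ∧ 6 * j ≠ m ∧
          ∀ k, α (σ k) = ![(j : ZMod m), (d : ZMod m) + j, 2 * (d : ZMod m) + j, -(3 * (j : ZMod m))] k) := by
  classical
  refine letter_of_isStandardQuadruple hα.1.1 hind ?_
  by_contra hns
  exact hno _ ⟨by simp, hα.isHodgeMultiset, not_hasPair_of_indecomposable hind, isPrimitive_of_forall_dvd hprim, hns⟩

end Bridge

end Literature.AlgebraicGeometry.Shioda1982
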